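import Literature.Topology.FourManifolds.PlumbingFunction
import HarnessLib

/-!
# The structure of the boundary `∂M(4m) = {ρ = ε}` of the plumbing over the base spheres

Topic `Literature/Topology/FourManifolds`; part of the construction of Kosinski's `M(4m)`
(A. Kosinski, *Differential Manifolds* (1993), VI.12), towards `π₁(∂M(4m)) = 1` (VI.(12.1):
"if `k > 2` then `∂B` is simply connected"). On the `v`-th tube the size function is a function
of the base point `p` and of the squared fibre radius `b` only: `ρ̂ᵥ(p, q) = Φᵥ(p, b(p, q))` for
the **radial profile** `Φᵥ(p, b) = b + Σⱼ 𝟙_{⟪p,eⱼ⟫ > c} (G(aⱼ(p), b) - b)`. Over the **good base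
region** `B̂ᵥ = {p | ⟪p, eⱼ⟫ < √(1 - ε) for the active poles eⱼ}` (the base sphere minus small
caps around the crossing points) the profile crosses the level `ε` exactly once along each
fibre, at a squared radius `β̂ᵥ(p) ∈ [ε, r²/2)` depending continuously on `p`; so the part of
`∂M(4m)` over `B̂ᵥ` is the graph-sphere-bundle `{(p, q) | p ∈ B̂ᵥ, b(p, q) = β̂ᵥ(p)}`.

* `Plumbing.aP e p = 1 - ⟪p, e⟫²`, `Plumbing.profile v p b`, `rhoHat_eq_profile`,
  `profile_eq_cornerFn_capA` (the uniform formula `Φᵥ(p, b) = G(Aᵥ(p), b)` with the cap value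
  `Aᵥ = Plumbing.capA`), `continuousAt_profile`;
* `continuousAt_root` — a continuous, fibrewise strictly monotone family has a continuous root;
* `exists_unique_cornerFn_eq`, `Plumbing.betaFn c ε a = β(a)` — the root of `G(a, ·) = ε`
  (`0 < ε < a ≤ r²`), `continuousOn_betaFn`, `betaFn_antitoneOn`, and the strict wedge
  inequality `cornerFn_lt_min` with the witness `lt_betaFn_wedgePt` of a level point with both
  coordinates `> ε`;
* `Plumbing.goodBase`, `Plumbing.levelRad v ε p = β(Aᵥ(p))`, `continuousOn_levelRad`, and
  `rhoHat_eq_iff_bFn_eq_levelRad` — over `{ε < Aᵥ}`, `ρ̂ᵥ(p, q) = ε ↔ b(p, q) = β̂ᵥ(p)`.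

Everything is proved; no named facts (D-0026).

## References

* A. Kosinski, *Differential Manifolds*, Academic Press 1993, VI.12, (12.1). [Kosinski1993]
-/

open scoped Manifold ContDiff Topology RealInnerProductSpace
open Set Function Module Filter

noncomputable section

namespace Literature.Topology.FourManifolds

namespace Plumbing

/-- Local notation: `𝔼 n` is the model Euclidean space `EuclideanSpace ℝ (Fin n)`. -/
local notation "𝔼 " n:arg => EuclideanSpace ℝ (Fin n)

/-- Local notation: `𝕊 n` is the unit sphere in `EuclideanSpace ℝ (Fin (n + 1))`. -/
local notation "𝕊 " n:arg => (Metric.sphere (0 : EuclideanSpace ℝ (Fin (n + 1))) 1)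

/-! ### §1 A continuous strictly monotone family has a continuous root -/

section Root

variable {X : Type*} [TopologicalSpace X]

/-- **Continuity of the root of a continuous, fibrewise strictly monotone family.** Let
`F : X → ℝ → ℝ`, continuous in `x` at `x₀` for each `t ∈ [a₀, b₀]` and continuous in `t` on
`[a₀, b₀]` for each `x` near `x₀`; suppose `F x₀` is strictly monotone on `[a₀, b₀]`, and that
for `x` near `x₀` the equation `F x t = ε` has the solution `r x ∈ (a₀, b₀)` and no other solution
in `[a₀, b₀]`. Then `r` is continuous at `x₀` (bracket the root of `F x₀` strictly, keep the
strict inequalities for nearby `x`, and apply the intermediate value theorem). [folklore] -/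
theorem continuousAt_root {F : X → ℝ → ℝ} {ε a₀ b₀ : ℝ} {r : X → ℝ} {x₀ : X} {U : Set X}
    (hU : U ∈ 𝓝 x₀) (hcontx : ∀ t ∈ Icc a₀ b₀, ContinuousAt (fun x => F x t) x₀)
    (hcontt : ∀ x ∈ U, ContinuousOn (F x) (Icc a₀ b₀))
    (hmono : StrictMonoOn (F x₀) (Icc a₀ b₀))
    (hroot : ∀ x ∈ U, F x (r x) = ε) (hmem : ∀ x ∈ U, r x ∈ Ioo a₀ b₀)
    (huniq : ∀ x ∈ U, ∀ t ∈ Icc a₀ b₀, F x t = ε → t = r x) :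
    ContinuousAt r x₀ := by
  have hx₀ : x₀ ∈ U := mem_of_mem_nhds hU
  obtain ⟨hr1, hr2⟩ := hmem x₀ hx₀
  rw [Metric.continuousAt_iff']
  intro η hη
  -- shrink `η` so that `[r x₀ - η', r x₀ + η'] ⊆ (a₀, b₀)`
  set η' := min (η / 2) (min ((r x₀ - a₀) / 2) ((b₀ - r x₀) / 2)) with hη'
  have hη'pos : 0 < η' := by
    simp only [hη', lt_min_iff]; refine ⟨by linarith, by linarith, by linarith⟩
  have hη'η : η' < η := by have := min_le_left (η / 2) (min ((r x₀ - a₀) / 2) ((b₀ - r x₀) / 2)); linarith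
  have hlo : a₀ < r x₀ - η' := by
    have h1 := min_le_right (η / 2) (min ((r x₀ - a₀) / 2) ((b₀ - r x₀) / 2))
    have h2 := min_le_left ((r x₀ - a₀) / 2) ((b₀ - r x₀) / 2)
    linarith
  have hhi : r x₀ + η' < b₀ := by
    have h1 := min_le_right (η / 2) (min ((r x₀ - a₀) / 2) ((b₀ - r x₀) / 2))
    have h2 := min_le_right ((r x₀ - a₀) / 2) ((b₀ - r x₀) / 2)
    linarith
  have hloI : r x₀ - η' ∈ Icc a₀ b₀ := ⟨hlo.le, by linarith⟩
  have hhiI : r x₀ + η' ∈ Icc a₀ b₀ := ⟨by linarith, hhi.le⟩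
  have hrI : r x₀ ∈ Icc a₀ b₀ := ⟨hr1.le, hr2.le⟩
  -- strict bracketing at `x₀`
  have h1 : F x₀ (r x₀ - η') < ε := by
    rw [← hroot x₀ hx₀]; exact hmono hloI hrI (by linarith)
  have h2 : ε < F x₀ (r x₀ + η') := by
    rw [← hroot x₀ hx₀]; exact hmono hrI hhiI (by linarith)
  -- the strict inequalities persist for `x` near `x₀`
  have e1 : ∀ᶠ x in 𝓝 x₀, F x (r x₀ - η') < ε := (hcontx _ hloI).eventually_lt continuousAt_const h1
  have e2 : ∀ᶠ x in 𝓝 x₀, ε < F x (r x₀ + η') := continuousAt_const.eventually_lt (hcontx _ hhiI) h2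
  filter_upwards [e1, e2, hU] with x hx1 hx2 hxU
  -- intermediate value theorem on `[r x₀ - η', r x₀ + η']`
  have hcx : ContinuousOn (F x) (Icc (r x₀ - η') (r x₀ + η')) :=
    (hcontt x hxU).mono (Icc_subset_Icc hlo.le hhi.le)
  obtain ⟨t, ht, hFt⟩ := intermediate_value_Icc (by linarith) hcx ⟨hx1.le, hx2.le⟩
  have htr : t = r x := huniq x hxU t ⟨by linarith [ht.1], by linarith [ht.2]⟩ hFt
  rw [Real.dist_eq, ← htr]
  have := ht.1; have := ht.2
  rw [abs_lt]; constructor <;> linarith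

end Root

/-! ### §2 The radial profile of the size function -/

section Profile

variable {k : ℕ} {c : ℝ}

/-- The squared base radius as a function of the base point alone: `a_e(p) = 1 - ⟪p, e⟫²`. [folklore] -/
def aP (e : 𝕊 k) (p : 𝕊 k) : ℝ := 1 - ⟪(p : 𝔼 (k + 1)), (e : 𝔼 (k + 1))⟫ ^ 2

/-- `aFn_eq_aP` (aFn eq aP). [folklore] -/
theorem aFn_eq_aP (e : 𝕊 k) (pq : (𝕊 k) × (𝕊 k)) : aFn e pq = aP e pq.1 := rfl

/-- `continuous_aP` (continuous aP). [folklore] -/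
theorem continuous_aP (e : 𝕊 k) : Continuous (aP e) := by unfold aP; fun_prop

/-- `aP_lt_rsq` (aP lt rsq). [folklore] -/
theorem aP_lt_rsq (e : 𝕊 k) {p : 𝕊 k} (hc : 0 ≤ c) (h : c < ⟪(p : 𝔼 (k + 1)), (e : 𝔼 (k + 1))⟫) :
    aP e p < rsq c := by rw [aP, rsq]; nlinarith

/-- `aP_nonneg` (aP nonneg). [folklore] -/
theorem aP_nonneg (e : 𝕊 k) (p : 𝕊 k) : 0 ≤ aP e p := aFn_nonneg e (p, p)

variable (k c) in
open Classical in
/-- **The correction term of the radial profile** of colour `j` at the base point `p`: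
`𝟙_{⟪p, e_j⟫ > c} (G(a_j(p), b) - b)`. [cite: Kosinski1993, VI.12 p. 120] -/
def profTerm (j : Fin 3) (p : 𝕊 k) (b : ℝ) : ℝ :=
  if c < ⟪(p : 𝔼 (k + 1)), (pole k j.val : 𝔼 (k + 1))⟫ then cornerFn (rsq c) bandSlope (aP (pole k j.val) p, b) - b else 0

/-- `profTerm_of_lt` (profTerm of lt). [folklore] -/
theorem profTerm_of_lt {j : Fin 3} {p : 𝕊 k} (h : c < ⟪(p : 𝔼 (k + 1)), (pole k j.val : 𝔼 (k + 1))⟫) (b : ℝ) :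
    profTerm k c j p b = cornerFn (rsq c) bandSlope (aP (pole k j.val) p, b) - b := by
  rw [profTerm, if_pos h]

/-- `profTerm_of_not_lt` (profTerm of not lt). [folklore] -/
theorem profTerm_of_not_lt {j : Fin 3} {p : 𝕊 k} (h : ¬ c < ⟪(p : 𝔼 (k + 1)), (pole k j.val : 𝔼 (k + 1))⟫) (b : ℝ) :
    profTerm k c j p b = 0 := by
  rw [profTerm, if_neg h]

/-- On the tube, the correction term of the size function is the profile term at the squared
fibre radius. [folklore] -/
theorem termFn_eq_profTerm {j : Fin 3} {pq : (𝕊 k) × (𝕊 k)} (htube : c < fibHt pq) :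
    termFn k c j pq = profTerm k c j pq.1 (bFn pq) := by
  by_cases h : c < ⟪(pq.1 : 𝔼 (k + 1)), (pole k j.val : 𝔼 (k + 1))⟫
  · rw [termFn_of_mem ⟨h, htube⟩, profTerm_of_lt h]; rfl
  · rw [termFn_of_not_mem (fun hd => h hd.1), profTerm_of_not_lt h]

variable (k c) in
/-- **The radial profile** of the size function of the `v`-th tube:
`Φᵥ(p, b) = b + Σ_{w ~ v} 𝟙_{⟪p, e_{vw}⟫ > c} (G(a_{vw}(p), b) - b)`. [cite: Kosinski1993, VI.12 pp. 120–122] -/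
def profile (v : Fin 8) (p : 𝕊 k) (b : ℝ) : ℝ :=
  b + ∑ w ∈ Finset.univ.filter (fun w => kosinskiGamma8 v w = 1), profTerm k c (ecol v w) p b

/-- **The size function is the radial profile at the squared fibre radius** (on the tube).
[folklore] -/
theorem rhoHat_eq_profile (v : Fin 8) {pq : (𝕊 k) × (𝕊 k)} (htube : c < fibHt pq) :
    rhoHat k c v pq = profile k c v pq.1 (bFn pq) := by
  rw [rhoHat, profile]
  congr 1
  exact Finset.sum_congr rfl fun w _ => termFn_eq_profTerm htube

/-- Off all caps of the edges at `v` the profile is the identity. [folklore] -/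
theorem profile_eq_self (v : Fin 8) {p : 𝕊 k}
    (h : ∀ w, kosinskiGamma8 v w = 1 → ⟪(p : 𝔼 (k + 1)), (pole k (ecol v w).val : 𝔼 (k + 1))⟫ ≤ c) (b : ℝ) :
    profile k c v p b = b := by
  rw [profile, add_eq_left]
  exact Finset.sum_eq_zero fun w hw => profTerm_of_not_lt (not_lt.2 (h w (by simpa using hw))) b

/-- In the cap of the edge `{v, w}` the profile is the corner function `G(a, b)` (the other caps
being disjoint from it). [folklore] -/
theorem profile_eq_cornerFn (hk : 2 ≤ k) (hc : IsParam c) {v w : Fin 8} (hvw : kosinskiGamma8 v w = 1)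
    {p : 𝕊 k} (h : c < ⟪(p : 𝔼 (k + 1)), (pole k (ecol v w).val : 𝔼 (k + 1))⟫) (b : ℝ) :
    profile k c v p b = cornerFn (rsq c) bandSlope (aP (pole k (ecol v w).val) p, b) := by
  rw [profile, Finset.sum_eq_single_of_mem w (by simp [hvw]), profTerm_of_lt h]
  · ring
  · intro w' hw' hne
    have hw'1 : kosinskiGamma8 v w' = 1 := by simpa using hw'
    apply profTerm_of_not_lt
    intro h'
    have hcol : ecol v w' ≠ ecol v w := fun heq => hne (ecol_injective_of_edge hw'1 hvw heq)
    exact not_lt_inner_and_lt_inner (norm_eq_of_mem_sphere (pole k (ecol v w').val))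
      (norm_eq_of_mem_sphere (pole k (ecol v w).val)) (inner_pole_pole_of_ne hk hcol)
      (norm_eq_of_mem_sphere p) hc.nonneg hc.half_le ⟨h', h⟩

/-! #### The cap value `A(p)` and the uniform formula `Φᵥ(p, b) = G(A(p), b)` -/

/-- `φ(t) = 1 - max(t, c)²`: equal to `r² = 1 - c²` for `t ≤ c` and to `1 - t²` for `t ≥ c`;
continuous. [folklore] -/
def phiCap (c t : ℝ) : ℝ := 1 - (max t c) ^ 2

/-- `phiCap_of_le` (phiCap of le). [folklore] -/
theorem phiCap_of_le {t : ℝ} (h : t ≤ c) : phiCap c t = rsq c := by rw [phiCap, max_eq_right h, rsq]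

/-- `phiCap_of_lt` (phiCap of lt). [folklore] -/
theorem phiCap_of_lt {t : ℝ} (h : c < t) : phiCap c t = 1 - t ^ 2 := by rw [phiCap, max_eq_left h.le]

/-- `phiCap_le_rsq` (phiCap le rsq). [folklore] -/
theorem phiCap_le_rsq (hc : 0 ≤ c) (t : ℝ) : phiCap c t ≤ rsq c := by
  rw [phiCap, rsq]
  have h1 : c ≤ max t c := le_max_right _ _
  nlinarith

/-- `continuous_phiCap` (continuous phiCap). [folklore] -/
theorem continuous_phiCap (c : ℝ) : Continuous (phiCap c) := by unfold phiCap; fun_prop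

/-- Every vertex of the `E₈` tree has a neighbour. [cite: Kosinski1993, VI.12 p. 122] -/
theorem nbrs_nonempty (v : Fin 8) : (Finset.univ.filter (fun w => kosinskiGamma8 v w = 1)).Nonempty := by
  fin_cases v
  · exact ⟨1, by simp; decide⟩
  · exact ⟨0, by simp; decide⟩
  · exact ⟨1, by simp; decide⟩
  · exact ⟨2, by simp; decide⟩
  · exact ⟨3, by simp; decide⟩
  · exact ⟨4, by simp; decide⟩
  · exact ⟨5, by simp; decide⟩
  · exact ⟨4, by simp; decide⟩

variable (k c) in
/-- **The cap value** `Aᵥ(p) = min_{w ~ v} φ(⟪p, e_{vw}⟫)`: the squared base radius `a_j(p)` when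
`p` lies in the cap of the edge of colour `j` at `v`, and `r²` off all these caps (at most one cap
contains `p`). Continuous in `p`. [folklore] -/
def capA (v : Fin 8) (p : 𝕊 k) : ℝ :=
  (Finset.univ.filter (fun w => kosinskiGamma8 v w = 1)).inf' (nbrs_nonempty v)
    (fun w => phiCap c ⟪(p : 𝔼 (k + 1)), (pole k (ecol v w).val : 𝔼 (k + 1))⟫)

/-- `continuous_capA` (continuous capA). [folklore] -/
theorem continuous_capA (v : Fin 8) : Continuous (capA k c v) := by
  unfold capA
  refine Continuous.finset_inf'_apply (nbrs_nonempty v) fun w _ => ?_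
  exact (continuous_phiCap c).comp (by fun_prop)

/-- `capA_le_rsq` (capA le rsq). [folklore] -/
theorem capA_le_rsq (hc : IsParam c) (v : Fin 8) (p : 𝕊 k) : capA k c v p ≤ rsq c := by
  obtain ⟨w, hw⟩ := nbrs_nonempty v
  exact (Finset.inf'_le _ hw).trans (phiCap_le_rsq hc.nonneg _)

/-- Off all caps the cap value is `r²`. [folklore] -/
theorem capA_eq_rsq (v : Fin 8) {p : 𝕊 k}
    (h : ∀ w, kosinskiGamma8 v w = 1 → ⟪(p : 𝔼 (k + 1)), (pole k (ecol v w).val : 𝔼 (k + 1))⟫ ≤ c) :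
    capA k c v p = rsq c := by
  unfold capA
  refine le_antisymm ?_ ?_
  · obtain ⟨w, hw⟩ := nbrs_nonempty v
    refine (Finset.inf'_le _ hw).trans ?_
    rw [phiCap_of_le (h w (by simpa using hw))]
  · refine Finset.le_inf' _ _ fun w hw => ?_
    rw [phiCap_of_le (h w (by simpa using hw))]

/-- In the cap of the edge `{v, w}` the cap value is the squared base radius `a(p)`. [folklore] -/
theorem capA_eq_aP (hk : 2 ≤ k) (hc : IsParam c) {v w : Fin 8} (hvw : kosinskiGamma8 v w = 1)
    {p : 𝕊 k} (h : c < ⟪(p : 𝔼 (k + 1)), (pole k (ecol v w).val : 𝔼 (k + 1))⟫) :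
    capA k c v p = aP (pole k (ecol v w).val) p := by
  unfold capA
  refine le_antisymm ?_ ?_
  · refine (Finset.inf'_le _ (show w ∈ Finset.univ.filter (fun w => kosinskiGamma8 v w = 1) by simp [hvw])).trans ?_
    rw [phiCap_of_lt h, aP]
  · refine Finset.le_inf' _ _ fun w' hw' => ?_
    by_cases hne : w' = w
    · subst hne; rw [phiCap_of_lt h, aP]
    · have hw'1 : kosinskiGamma8 v w' = 1 := by simpa using hw'
      have hcol : ecol v w' ≠ ecol v w := fun heq => hne (ecol_injective_of_edge hw'1 hvw heq)
      have hle : ⟪(p : 𝔼 (k + 1)), (pole k (ecol v w').val : 𝔼 (k + 1))⟫ ≤ c := by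
        by_contra hlt
        exact not_lt_inner_and_lt_inner (norm_eq_of_mem_sphere (pole k (ecol v w').val))
          (norm_eq_of_mem_sphere (pole k (ecol v w).val)) (inner_pole_pole_of_ne hk hcol)
          (norm_eq_of_mem_sphere p) hc.nonneg hc.half_le ⟨lt_of_not_ge hlt, h⟩
      rw [phiCap_of_le hle]
      exact (aP_lt_rsq _ hc.nonneg h).le

/-- The corner function with base value `r²` is the identity in `b < r²` (the wedge condition
`r² - b ≥ s (r² - b)` holds). [folklore] -/
theorem cornerFn_rsq_left {b : ℝ} (hb : b < rsq c) : cornerFn (rsq c) bandSlope (rsq c, b) = b := by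
  have hwedge : bandW (rsq c) bandSlope (rsq c, b) ≤ |rsq c - b| := by
    simp only [bandW, bandSlope]
    rw [abs_of_pos (by linarith)]; linarith
  rw [cornerFn_eq_min bandSlope_pos (by simp only; linarith) hwedge]
  simp only
  rw [min_eq_right hb.le]

/-- **The uniform formula for the radial profile**: `Φᵥ(p, b) = G(Aᵥ(p), b)` for `b < r²`. [folklore] -/
theorem profile_eq_cornerFn_capA (hk : 2 ≤ k) (hc : IsParam c) (v : Fin 8) (p : 𝕊 k) {b : ℝ} (hb : b < rsq c) :
    profile k c v p b = cornerFn (rsq c) bandSlope (capA k c v p, b) := by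
  by_cases hcap : ∃ w, kosinskiGamma8 v w = 1 ∧ c < ⟪(p : 𝔼 (k + 1)), (pole k (ecol v w).val : 𝔼 (k + 1))⟫
  · obtain ⟨w, hvw, h⟩ := hcap
    rw [profile_eq_cornerFn hk hc hvw h, capA_eq_aP hk hc hvw h]
  · push Not at hcap
    rw [profile_eq_self v hcap, capA_eq_rsq v hcap, cornerFn_rsq_left hb]

/-- **Joint continuity of the radial profile** at points with `b < r²`. [folklore] -/
theorem continuousAt_profile (hk : 2 ≤ k) (hc : IsParam c) (v : Fin 8) {p : 𝕊 k} {b : ℝ} (hb : b < rsq c) :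
    ContinuousAt (fun x : (𝕊 k) × ℝ => profile k c v x.1 x.2) (p, b) := by
  have hG : ContinuousAt (fun x : (𝕊 k) × ℝ => cornerFn (rsq c) bandSlope (capA k c v x.1, x.2)) (p, b) := by
    have hpair : ContinuousAt (fun x : (𝕊 k) × ℝ => (capA k c v x.1, x.2)) (p, b) :=
      (((continuous_capA v).comp continuous_fst).prodMk continuous_snd).continuousAt
    have hlt : (capA k c v p, b).1 + (capA k c v p, b).2 < 2 * rsq c := by
      simp only; linarith [capA_le_rsq hc v p]
    exact ContinuousAt.comp (f := fun x : (𝕊 k) × ℝ => (capA k c v x.1, x.2)) (x := (p, b))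
      (contDiffAt_cornerFn (n := 0) bandSlope_pos hlt).continuousAt hpair
  refine hG.congr ?_
  have hopen : IsOpen {x : (𝕊 k) × ℝ | x.2 < rsq c} := isOpen_lt continuous_snd continuous_const
  filter_upwards [hopen.mem_nhds hb] with x hx
  exact (profile_eq_cornerFn_capA hk hc v x.1 hx).symm

/-! #### Monotonicity in `b` -/

/-- The profile is monotone in `b` below `r²`. [folklore] -/
theorem profile_mono (hk : 2 ≤ k) (hc : IsParam c) (v : Fin 8) (p : 𝕊 k) {b b' : ℝ} (hbb' : b ≤ b')
    (hb' : b' < rsq c) : profile k c v p b ≤ profile k c v p b' := by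
  rw [profile_eq_cornerFn_capA hk hc v p (hbb'.trans_lt hb'), profile_eq_cornerFn_capA hk hc v p hb']
  exact cornerFn_mono_snd bandSlope_pos hbb' (by linarith [capA_le_rsq hc v p])

/-- The profile at `b = 0` is `≤ 0`. [folklore] -/
theorem profile_zero_nonpos (hk : 2 ≤ k) (hc : IsParam c) (v : Fin 8) (p : 𝕊 k) : profile k c v p 0 ≤ 0 := by
  rw [profile_eq_cornerFn_capA hk hc v p (rsq_pos hc)]
  exact cornerFn_nonpos bandSlope_pos (by simp only; linarith [capA_le_rsq hc v p, rsq_pos hc]) (by simp)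

/-- The profile is `≤ b` (`b < r²`). [folklore] -/
theorem profile_le (hk : 2 ≤ k) (hc : IsParam c) (v : Fin 8) (p : 𝕊 k) {b : ℝ} (hb : b < rsq c) :
    profile k c v p b ≤ b := by
  rw [profile_eq_cornerFn_capA hk hc v p hb]
  exact (cornerFn_le_min bandSlope_pos (by simp only; linarith [capA_le_rsq hc v p])).trans (min_le_right _ _)

/-- **Positivity of the fibre slope below the wedge**: `G_b(a, b) > 0` wherever
`b (1 + s) < a (1 - s) + 2 s r²` (i.e. the ratio `t > -1`). [folklore] -/
theorem slopeB_pos {a b : ℝ} (hs : 0 < bandSlope) (hab : a + b < 2 * rsq c)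
    (h : b * (1 + bandSlope) < a * (1 - bandSlope) + 2 * bandSlope * rsq c) :
    0 < slopeB (rsq c) bandSlope (a, b) := by
  have hσ : 0 < bandW (rsq c) bandSlope (a, b) := bandW_pos hs hab
  have ht : -1 < ratio (rsq c) bandSlope (a, b) := by
    rw [ratio, lt_div_iff₀ hσ]
    simp only [bandW]
    nlinarith
  unfold slopeB
  have hμ : -1 < oddTrans (ratio (rsq c) bandSlope (a, b)) := by
    unfold oddTrans
    have : 0 < Real.smoothTransition ((ratio (rsq c) bandSlope (a, b) + 1) / 2) :=
      Real.smoothTransition.pos_of_pos (by linarith)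
    linarith
  have hg := gap_nonneg (ratio (rsq c) bandSlope (a, b))
  nlinarith

/-- The strict-monotonicity bound `b₁(a) = (a (1 - s) + 2 s r²)/(1 + s)`: below it `G(a, ·)` is
strictly increasing; `G(a, b₁(a)) = a`. [folklore] -/
def sbound (c a : ℝ) : ℝ := (a * (1 - bandSlope) + 2 * bandSlope * rsq c) / (1 + bandSlope)

/-- `sbound_le_rsq` (sbound le rsq). [folklore] -/
theorem sbound_le_rsq {a : ℝ} (ha : a ≤ rsq c) : sbound c a ≤ rsq c := by
  rw [sbound, div_le_iff₀ (by norm_num [bandSlope])]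
  have := bandSlope_pos; have := bandSlope_lt_one; nlinarith

/-- `sbound_lt_rsq` (sbound lt rsq). [folklore] -/
theorem sbound_lt_rsq {a : ℝ} (ha : a < rsq c) : sbound c a < rsq c := by
  rw [sbound, div_lt_iff₀ (by norm_num [bandSlope])]
  have := bandSlope_pos; have := bandSlope_lt_one; nlinarith

/-- `sbound_mono` (sbound mono). [folklore] -/
theorem sbound_mono {a a' : ℝ} (h : a ≤ a') : sbound c a ≤ sbound c a' := by
  rw [sbound, sbound]
  apply div_le_div_of_nonneg_right _ (by norm_num [bandSlope])
  have := bandSlope_lt_one; nlinarith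

/-- `lt_sbound_iff` (lt sbound iff). [folklore] -/
theorem lt_sbound_iff {a b : ℝ} : b < sbound c a ↔ b * (1 + bandSlope) < a * (1 - bandSlope) + 2 * bandSlope * rsq c := by
  rw [sbound, lt_div_iff₀ (by norm_num [bandSlope])]

/-- `lt_sbound_self` (lt sbound self). [folklore] -/
theorem lt_sbound_self {a : ℝ} (ha : a < rsq c) : a < sbound c a := by
  rw [lt_sbound_iff]; have := bandSlope_pos; nlinarith

/-- `continuous_sbound` (continuous sbound). [folklore] -/
theorem continuous_sbound : Continuous (sbound c) := by unfold sbound; fun_prop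

/-- At `b = b₁(a)` the corner function takes the value `a` (`a < r²`). [folklore] -/
theorem cornerFn_sbound {a : ℝ} (ha : a < rsq c) : cornerFn (rsq c) bandSlope (a, sbound c a) = a := by
  have hsb := sbound_lt_rsq (c := c) ha
  have hlt := lt_sbound_self (c := c) ha
  have hwedge : bandW (rsq c) bandSlope (a, sbound c a) ≤ |a - sbound c a| := by
    simp only [bandW]
    rw [abs_of_neg (by linarith)]
    have h : sbound c a * (1 + bandSlope) = a * (1 - bandSlope) + 2 * bandSlope * rsq c := by
      rw [sbound, div_mul_cancel₀ _ (by norm_num [bandSlope])]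
    nlinarith
  rw [cornerFn_eq_min bandSlope_pos (by simp only; linarith) hwedge]
  simp only; rw [min_eq_left hlt.le]

/-- **`G(a, ·)` is strictly increasing on `[0, b₀]` for `b₀ < b₁(a)`** (`a ≤ r²`). [folklore] -/
theorem strictMonoOn_cornerFn_snd {a : ℝ} (ha : a ≤ rsq c) {b₀ : ℝ} (hb₀ : b₀ < sbound c a) :
    StrictMonoOn (fun b => cornerFn (rsq c) bandSlope (a, b)) (Icc 0 b₀) := by
  have hsb := sbound_le_rsq (c := c) ha
  refine strictMonoOn_of_deriv_pos (convex_Icc 0 b₀) ?_ ?_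
  · intro b hb
    exact (hasDerivAt_cornerFn_snd bandSlope_pos (by linarith [hb.2])).continuousAt.continuousWithinAt
  · intro b hb
    rw [interior_Icc] at hb
    rw [(hasDerivAt_cornerFn_snd bandSlope_pos (by linarith [hb.2])).deriv]
    exact slopeB_pos bandSlope_pos (by linarith [hb.2]) (lt_sbound_iff.1 (hb.2.trans hb₀))

/-- Values of `G(a, ·)` below `a` force `b < b₁(a)`. [folklore] -/
theorem lt_sbound_of_cornerFn_lt {a b : ℝ} (hab : a + b < 2 * rsq c) (h : cornerFn (rsq c) bandSlope (a, b) < a) :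
    b < sbound c a := by
  rw [lt_sbound_iff]
  by_contra hle
  push Not at hle
  simp only [bandSlope] at hle
  have haR : a < rsq c := by linarith
  have hba : a ≤ b := by linarith
  have hwedge : bandW (rsq c) bandSlope (a, b) ≤ |a - b| := by
    simp only [bandW, bandSlope]
    rw [abs_of_nonpos (by linarith)]
    linarith
  rw [cornerFn_eq_min bandSlope_pos hab hwedge] at h
  simp only at h
  rw [min_eq_left hba] at h
  exact lt_irrefl _ h

/-! ### §3 The root `β(a)` of `G(a, ·) = ε` -/
/-- A Lipschitz bound from the slope bound `G_b ≤ 1 + s`: `G(a, b') - G(a, b) ≤ (1 + s)(b' - b)`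
for `b ≤ b' < 2r² - a`. [folklore] -/
theorem cornerFn_sub_le {a b b' : ℝ} (hbb' : b ≤ b') (hab' : a + b' < 2 * rsq c) :
    cornerFn (rsq c) bandSlope (a, b') - cornerFn (rsq c) bandSlope (a, b) ≤ (1 + bandSlope) * (b' - b) := by
  -- the function `u ↦ (1 + s) u - G(a, u)` is monotone on `(-∞, 2r² - a)`
  have hmono : MonotoneOn (fun u => (1 + bandSlope) * u - cornerFn (rsq c) bandSlope (a, u)) (Iio (2 * rsq c - a)) := by
    refine monotoneOn_of_deriv_nonneg (convex_Iio _) ?_ ?_ ?_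
    · intro u hu
      have hu' : a + u < 2 * rsq c := by have := mem_Iio.1 hu; linarith
      exact (((hasDerivAt_id u).const_mul _).sub (hasDerivAt_cornerFn_snd bandSlope_pos hu')).continuousAt.continuousWithinAt
    · intro u hu
      rw [interior_Iio] at hu
      have hu' : a + u < 2 * rsq c := by have := mem_Iio.1 hu; linarith
      exact (((hasDerivAt_id u).const_mul _).sub (hasDerivAt_cornerFn_snd bandSlope_pos hu')).differentiableAt.differentiableWithinAt
    · intro u hu
      rw [interior_Iio] at hu
      have hu' : a + u < 2 * rsq c := by have := mem_Iio.1 hu; linarith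
      have hd : HasDerivAt (fun u => (1 + bandSlope) * u - cornerFn (rsq c) bandSlope (a, u))
          ((1 + bandSlope) * 1 - slopeB (rsq c) bandSlope (a, u)) u :=
        ((hasDerivAt_id u).const_mul _).sub (hasDerivAt_cornerFn_snd bandSlope_pos hu')
      rw [hd.deriv]
      have := slopeB_le (r2 := rsq c) bandSlope_pos (a, u)
      linarith
  have := hmono (show b ∈ Iio (2 * rsq c - a) by rw [mem_Iio]; linarith)
    (show b' ∈ Iio (2 * rsq c - a) by rw [mem_Iio]; linarith) hbb'
  simp only at this
  linarith

/-- The upper end `T(a) = b₁(a) - (a - ε)/(2 (1 + s))` of the root interval. [folklore] -/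
def tUp (c ε a : ℝ) : ℝ := sbound c a - (a - ε) / (2 * (1 + bandSlope))

/-- `continuous_tUp` (continuous tUp). [folklore] -/
theorem continuous_tUp (ε : ℝ) : Continuous (tUp c ε) := by unfold tUp; exact continuous_sbound.sub (by fun_prop)

/-- `tUp_lt_sbound` (tUp lt sbound). [folklore] -/
theorem tUp_lt_sbound {ε a : ℝ} (h : ε < a) : tUp c ε a < sbound c a := by
  rw [tUp]
  have : 0 < (a - ε) / (2 * (1 + bandSlope)) := div_pos (sub_pos.2 h) (by norm_num [bandSlope])
  linarith

/-- `sbound_rsq` (sbound rsq). [folklore] -/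
theorem sbound_rsq : sbound c (rsq c) = rsq c := by
  rw [sbound, div_eq_iff (by norm_num [bandSlope])]; ring

/-- `a + T(a) < 2r²` (`ε < a ≤ r²`). [folklore] -/
theorem add_tUp_lt {ε a : ℝ} (h : ε < a) (ha : a ≤ rsq c) : a + tUp c ε a < 2 * rsq c := by
  have h1 := tUp_lt_sbound (c := c) h
  have h2 := sbound_le_rsq (c := c) ha
  rcases ha.lt_or_eq with hlt | heq
  · linarith
  · subst heq
    rw [tUp, sbound_rsq]
    have : 0 < (rsq c - ε) / (2 * (1 + bandSlope)) := div_pos (sub_pos.2 h) (by norm_num [bandSlope])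
    linarith

/-- **`G(a, T(a)) > ε`** (`ε < a ≤ r²`): from `G(a, b₁(a)) = a` (or `G(r², ·) = id`) and the
Lipschitz bound. [folklore] -/
theorem lt_cornerFn_tUp {ε a : ℝ} (h : ε < a) (ha : a ≤ rsq c) : ε < cornerFn (rsq c) bandSlope (a, tUp c ε a) := by
  have hT := tUp_lt_sbound (c := c) h
  have hs := bandSlope_pos
  rcases ha.lt_or_eq with hlt | heq
  · have hval := cornerFn_sbound (c := c) hlt
    have hlip := cornerFn_sub_le (c := c) (a := a) hT.le (by linarith [sbound_lt_rsq (c := c) hlt])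
    rw [hval] at hlip
    have : (1 + bandSlope) * (sbound c a - tUp c ε a) = (a - ε) / 2 := by
      rw [tUp]; field_simp; ring
    linarith
  · subst heq
    have hT' : tUp c ε (rsq c) < rsq c := by
      have := add_tUp_lt (c := c) h le_rfl; linarith
    rw [cornerFn_rsq_left hT']
    rw [tUp, sbound_rsq]
    have hs1 := bandSlope_lt_one
    have : (rsq c - ε) / (2 * (1 + bandSlope)) < rsq c - ε := by
      rw [div_lt_iff₀ (by positivity)]; nlinarith
    linarith

/-- **Existence and uniqueness of the root.** For `0 < ε < a ≤ r²` there is a unique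
`b ∈ [0, b₁(a))` with `G(a, b) = ε`; it lies in `(0, T(a))` (intermediate value theorem on
`[0, T(a)]`, strict monotonicity below `b₁(a)`). [folklore] -/
theorem exists_unique_cornerFn_eq {ε a : ℝ} (hε : 0 < ε) (ha : ε < a) (haR : a ≤ rsq c) :
    ∃! b, b ∈ Ico 0 (sbound c a) ∧ cornerFn (rsq c) bandSlope (a, b) = ε := by
  have hT := tUp_lt_sbound (c := c) ha
  have haT := add_tUp_lt (c := c) ha haR
  have hsbR := sbound_le_rsq (c := c) haR
  have hcont : ContinuousOn (fun b => cornerFn (rsq c) bandSlope (a, b)) (Icc 0 (tUp c ε a)) := fun b hb =>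
    (hasDerivAt_cornerFn_snd bandSlope_pos (by linarith [hb.2])).continuousAt.continuousWithinAt
  have h0 : cornerFn (rsq c) bandSlope (a, 0) ≤ ε :=
    (cornerFn_nonpos bandSlope_pos (by simp only; linarith) (by simp)).trans hε.le
  have h1 : ε ≤ cornerFn (rsq c) bandSlope (a, tUp c ε a) := (lt_cornerFn_tUp ha haR).le
  have hT0 : 0 ≤ tUp c ε a := by
    by_contra hneg; push Not at hneg
    have := cornerFn_mono_snd bandSlope_pos (r2 := rsq c) (a := a) hneg.le (by linarith : a + 0 < 2 * rsq c)
    linarith [lt_cornerFn_tUp (c := c) ha haR]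
  obtain ⟨b, hb, hbε⟩ := intermediate_value_Icc hT0 hcont ⟨h0, h1⟩
  refine ⟨b, ⟨⟨hb.1, hb.2.trans_lt hT⟩, hbε⟩, ?_⟩
  rintro b' ⟨hb', hb'ε⟩
  by_contra hne
  rcases lt_or_gt_of_ne hne with hlt | hgt
  · have hm := strictMonoOn_cornerFn_snd (c := c) haR (b₀ := b) (hb.2.trans_lt hT)
    have := hm ⟨hb'.1, hlt.le⟩ ⟨hb.1, le_rfl⟩ hlt
    simp only at this; linarith
  · have hm := strictMonoOn_cornerFn_snd (c := c) haR (b₀ := b') hb'.2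
    have := hm ⟨hb.1, hgt.le⟩ ⟨hb'.1, le_rfl⟩ hgt
    simp only at this; linarith

open Classical in
/-- **The root function** `β(a) = β_ε(a)`: the unique `b ∈ [0, b₁(a))` with `G(a, b) = ε`
(for `0 < ε < a ≤ r²`; `0` otherwise). The level curve `{G = ε}` is the graph of `β` over
`a > ε` together with the segment `{a = ε, b ≥ b₁… }`; over the good base region the level
`{ρ̂ᵥ = ε}` is `{b = β(Aᵥ(p))}`. [folklore] -/
def betaFn (c ε a : ℝ) : ℝ :=
  if h : ∃ b, b ∈ Ico 0 (sbound c a) ∧ cornerFn (rsq c) bandSlope (a, b) = ε then Classical.choose h else 0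

section Beta

variable {ε : ℝ} (hε : 0 < ε)
include hε

/-- The defining properties of `β(a)`. [folklore] -/
theorem betaFn_spec {a : ℝ} (ha : ε < a) (haR : a ≤ rsq c) :
    betaFn c ε a ∈ Ico 0 (sbound c a) ∧ cornerFn (rsq c) bandSlope (a, betaFn c ε a) = ε := by
  have h := (exists_unique_cornerFn_eq hε ha haR).exists
  rw [betaFn, dif_pos h]
  exact Classical.choose_spec h

/-- `G(a, β(a)) = ε`. [folklore] -/
theorem cornerFn_betaFn {a : ℝ} (ha : ε < a) (haR : a ≤ rsq c) :
    cornerFn (rsq c) bandSlope (a, betaFn c ε a) = ε := (betaFn_spec hε ha haR).2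

/-- **Uniqueness**: any root in `[0, b₁(a))` is `β(a)`. [folklore] -/
theorem eq_betaFn {a : ℝ} (ha : ε < a) (haR : a ≤ rsq c) {b : ℝ} (hb : b ∈ Ico 0 (sbound c a))
    (h : cornerFn (rsq c) bandSlope (a, b) = ε) : b = betaFn c ε a :=
  (exists_unique_cornerFn_eq hε ha haR).unique ⟨hb, h⟩ (betaFn_spec hε ha haR)

/-- `β(a) < b₁(a)`. [folklore] -/
theorem betaFn_lt_sbound {a : ℝ} (ha : ε < a) (haR : a ≤ rsq c) : betaFn c ε a < sbound c a :=
  (betaFn_spec hε ha haR).1.2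

/-- `β(a) < r²`. [folklore] -/
theorem betaFn_lt_rsq {a : ℝ} (ha : ε < a) (haR : a ≤ rsq c) : betaFn c ε a < rsq c :=
  (betaFn_lt_sbound hε ha haR).trans_le (sbound_le_rsq haR)

/-- `β(a) < T(a)`. [folklore] -/
theorem betaFn_lt_tUp {a : ℝ} (ha : ε < a) (haR : a ≤ rsq c) : betaFn c ε a < tUp c ε a := by
  obtain ⟨hmem, hval⟩ := betaFn_spec hε ha haR
  by_contra hle; push Not at hle
  have h1 := lt_cornerFn_tUp (c := c) ha haR
  have := cornerFn_mono_snd bandSlope_pos (r2 := rsq c) (a := a) hle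
    (by linarith [hmem.2, sbound_le_rsq (c := c) haR])
  linarith

/-- `0 < β(a)`. [folklore] -/
theorem betaFn_pos {a : ℝ} (ha : ε < a) (haR : a ≤ rsq c) : 0 < betaFn c ε a := by
  obtain ⟨hmem, hval⟩ := betaFn_spec hε ha haR
  rcases hmem.1.lt_or_eq with h | h
  · exact h
  · have h0 : cornerFn (rsq c) bandSlope (a, 0) ≤ 0 :=
      cornerFn_nonpos bandSlope_pos (by simp only; linarith) (by simp)
    rw [h] at h0; linarith

/-- `ε ≤ β(a)` (`G ≤ min`). [folklore] -/
theorem le_betaFn {a : ℝ} (ha : ε < a) (haR : a ≤ rsq c) : ε ≤ betaFn c ε a := by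
  obtain ⟨hmem, hval⟩ := betaFn_spec hε ha haR
  have hlt : a + betaFn c ε a < 2 * rsq c := by linarith [hmem.2, sbound_le_rsq (c := c) haR]
  have := (cornerFn_le_min bandSlope_pos (p := (a, betaFn c ε a)) hlt).trans (min_le_right _ _)
  rw [hval] at this; exact this

/-- **Continuity of the root function** on `(ε, r²]`. [folklore] -/
theorem continuousOn_betaFn : ContinuousOn (betaFn c ε) (Ioc ε (rsq c)) := by
  rw [continuousOn_iff_continuous_restrict, continuous_iff_continuousAt]
  rintro ⟨a₀, ha₀, ha₀R⟩
  set b₀ := tUp c ε a₀ with hb₀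
  have hT := tUp_lt_sbound (c := c) ha₀
  have hb₀R : b₀ < rsq c := hT.trans_le (sbound_le_rsq ha₀R)
  -- the neighbourhood `U`
  set U : Set (Ioc ε (rsq c)) := {x | b₀ < sbound c x.1} ∩ {x | ε < cornerFn (rsq c) bandSlope (x.1, b₀)} with hU
  have hGcont : ∀ {t : ℝ}, t < rsq c → Continuous fun x : Ioc ε (rsq c) => cornerFn (rsq c) bandSlope (x.1, t) := by
    intro t ht
    rw [continuous_iff_continuousAt]
    rintro ⟨a, ha, haR⟩
    exact ContinuousAt.comp (f := fun x : Ioc ε (rsq c) => ((x.1 : ℝ), t)) (x := ⟨a, ha, haR⟩)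
      (contDiffAt_cornerFn (n := 0) bandSlope_pos (by simp only; linarith)).continuousAt
      (continuous_subtype_val.prodMk continuous_const).continuousAt
  have hUo : IsOpen U :=
    (isOpen_lt continuous_const (continuous_sbound.comp continuous_subtype_val)).inter
      (isOpen_lt continuous_const (hGcont hb₀R))
  have hx₀U : (⟨a₀, ha₀, ha₀R⟩ : Ioc ε (rsq c)) ∈ U := ⟨hT, lt_cornerFn_tUp ha₀ ha₀R⟩
  have key : ContinuousAt (fun x : Ioc ε (rsq c) => betaFn c ε x.1) ⟨a₀, ha₀, ha₀R⟩ := by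
    refine continuousAt_root (F := fun (x : Ioc ε (rsq c)) b => cornerFn (rsq c) bandSlope (x.1, b))
      (ε := ε) (a₀ := 0) (b₀ := b₀) (hUo.mem_nhds hx₀U) ?_ ?_ ?_ ?_ ?_ ?_
    · intro t ht; exact (hGcont (ht.2.trans_lt hb₀R)).continuousAt
    · rintro ⟨a, ha, haR⟩ _ t ht
      exact (hasDerivAt_cornerFn_snd bandSlope_pos (by linarith [ht.2])).continuousAt.continuousWithinAt
    · intro b hb b' hb' hlt
      exact strictMonoOn_cornerFn_snd ha₀R hT hb hb' hlt
    · rintro ⟨a, ha, haR⟩ _; exact cornerFn_betaFn hε ha haR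
    · rintro ⟨a, ha, haR⟩ hx
      refine ⟨betaFn_pos hε ha haR, ?_⟩
      obtain ⟨hmem, hval⟩ := betaFn_spec hε ha haR
      by_contra hle; push Not at hle
      have := cornerFn_mono_snd bandSlope_pos (r2 := rsq c) (a := a) hle
        (by linarith [hmem.2, sbound_le_rsq (c := c) haR])
      have h2 : ε < cornerFn (rsq c) bandSlope (a, b₀) := hx.2
      linarith
    · rintro ⟨a, ha, haR⟩ hx t ht hFt
      exact eq_betaFn hε ha haR ⟨ht.1, ht.2.trans_lt hx.1⟩ hFt
  exact key

/-- **`β` is antitone**: along the level curve, `b` decreases as `a` increases (strict increase of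
`G` in the diagonal direction and monotonicity in each variable). [folklore] -/
theorem betaFn_antitoneOn : AntitoneOn (betaFn c ε) (Ioc ε (rsq c)) := by
  rintro a ⟨ha, haR⟩ a' ⟨ha', ha'R⟩ haa'
  by_contra hlt; push Not at hlt
  rcases haa'.lt_or_eq with haa' | rfl
  swap; · exact lt_irrefl _ hlt
  set τ := min (a' - a) (betaFn c ε a' - betaFn c ε a) with hτ
  have hτpos : 0 < τ := lt_min (by linarith) (by linarith)
  have hτ1 : τ ≤ a' - a := min_le_left _ _
  have hτ2 : τ ≤ betaFn c ε a' - betaFn c ε a := min_le_right _ _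
  have hb'R := betaFn_lt_rsq hε ha' ha'R
  have h1 := cornerFn_add_le_cornerFn_diag bandSlope_pos (r2 := rsq c) (a := a) (b := betaFn c ε a) hτpos.le
    (by linarith)
  have h2 := cornerFn_mono_fst bandSlope_pos (r2 := rsq c) (b := betaFn c ε a + τ)
    (show a + τ ≤ a' by linarith) (by linarith)
  have h3 := cornerFn_mono_snd bandSlope_pos (r2 := rsq c) (a := a')
    (show betaFn c ε a + τ ≤ betaFn c ε a' by linarith) (by linarith)
  rw [cornerFn_betaFn hε ha haR] at h1
  rw [cornerFn_betaFn hε ha' ha'R] at h3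
  linarith

end Beta

/-! #### The strict inequality `G < min` inside the wedge -/

/-- `|t| < A(t)` for `|t| < 1` (the smoothed absolute value is strictly above `|t|` inside the
band: `A - id` is strictly decreasing on `[t, 1]` since its derivative `μ - 1` is negative for
`t < 1`, and `A` is even). [folklore] -/
theorem abs_lt_sabs {t : ℝ} (ht : |t| < 1) : |t| < sabs t := by
  -- reduce to `0 ≤ t < 1`
  wlog h0 : 0 ≤ t generalizing t
  · have := this (t := -t) (by rwa [abs_neg]) (by linarith [le_of_not_ge h0])
    rwa [abs_neg, sabs_neg] at this
  rw [abs_of_nonneg h0] at ht ⊢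
  have hanti : StrictAntiOn (fun u => sabs u - u) (Icc t 1) := by
    refine strictAntiOn_of_deriv_neg (convex_Icc t 1) ?_ ?_
    · exact ((contDiff_sabs (n := 1)).continuous.sub continuous_id).continuousOn
    · intro u hu
      rw [interior_Icc] at hu
      have hd : HasDerivAt (fun u => sabs u - u) (oddTrans u - 1) u := (hasDerivAt_sabs u).sub (hasDerivAt_id u)
      rw [hd.deriv]
      have : oddTrans u < 1 := by
        unfold oddTrans
        have := Real.smoothTransition.lt_one_of_lt_one (x := (u + 1) / 2) (by linarith [hu.2])
        linarith
      linarith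
  have := hanti ⟨le_rfl, ht.le⟩ ⟨ht.le, le_rfl⟩ ht
  simp only [sabs_one, sub_self] at this
  linarith

/-- **Strictly inside the wedge the corner function is below the minimum**:
`|a - b| < s (2r² - a - b) ⇒ G(a, b) < min(a, b)`. [folklore] -/
theorem cornerFn_lt_min {r2 s : ℝ} (hs : 0 < s) {p : ℝ × ℝ} (hp : p.1 + p.2 < 2 * r2)
    (h : |p.1 - p.2| < bandW r2 s p) : cornerFn r2 s p < min p.1 p.2 := by
  have hσ := bandW_pos hs hp
  have h1 : |(p.1 - p.2) / bandW r2 s p| < 1 := by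
    rw [abs_div, abs_of_pos hσ, div_lt_one hσ]; exact h
  have h2 := abs_lt_sabs h1
  rw [abs_div, abs_of_pos hσ, div_lt_iff₀ hσ] at h2
  unfold cornerFn
  have h3 : |p.1 - p.2| / 2 < bandW r2 s p / 2 * sabs ((p.1 - p.2) / bandW r2 s p) := by nlinarith
  rcases le_total p.1 p.2 with hle | hle
  · rw [min_eq_left hle]; rw [abs_of_nonpos (by linarith)] at h3; linarith
  · rw [min_eq_right hle]; rw [abs_of_nonneg (by linarith)] at h3; linarith

/-- **A point of the level curve with both coordinates `> ε`**: for `a = ε + s (r² - ε)/2` one has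
`ε < a ≤ r²` and `β(a) > ε` (the point `(a, ε)` lies strictly inside the wedge, where `G < min`).
[folklore] -/
theorem lt_betaFn_wedgePt {ε : ℝ} (hε : 0 < ε) (hεR : ε < rsq c) :
    ε < ε + bandSlope * (rsq c - ε) / 2 ∧ ε + bandSlope * (rsq c - ε) / 2 < rsq c ∧
      ε < betaFn c ε (ε + bandSlope * (rsq c - ε) / 2) := by
  set a := ε + bandSlope * (rsq c - ε) / 2 with ha_def
  have hs := bandSlope_pos
  have hs1 := bandSlope_lt_one
  have ha : ε < a := by rw [ha_def]; nlinarith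
  have haR : a < rsq c := by rw [ha_def]; nlinarith
  refine ⟨ha, haR, ?_⟩
  rcases (le_betaFn hε ha haR.le).lt_or_eq with h | h
  · exact h
  · exfalso
    have hval := cornerFn_betaFn hε ha haR.le
    rw [← h] at hval
    have hwedge : |a - ε| < bandW (rsq c) bandSlope (a, ε) := by
      simp only [bandW]
      rw [abs_of_pos (by linarith), ha_def]
      nlinarith
    have := cornerFn_lt_min bandSlope_pos (p := (a, ε)) (by simp only; linarith) hwedge
    simp only at this
    rw [hval, min_eq_right ha.le] at this
    exact lt_irrefl _ this

/-! ### §4 The level radius over the good base region -/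

variable (k c) in
/-- **The good base region** of the `v`-th tube at level `ε`:
`B̂ᵥ = {p | ⟪p, e_{vw}⟫ < √(1 - ε) for every edge {v, w}}` (the base sphere minus small caps
around the crossing points). [folklore] -/
def goodBase (v : Fin 8) (ε : ℝ) : Set (𝕊 k) :=
  {p | ∀ w, kosinskiGamma8 v w = 1 → ⟪(p : 𝔼 (k + 1)), (pole k (ecol v w).val : 𝔼 (k + 1))⟫ < Real.sqrt (1 - ε)}

/-- `isOpen_goodBase` (isOpen goodBase). [folklore] -/
theorem isOpen_goodBase (v : Fin 8) (ε : ℝ) : IsOpen (goodBase k v ε) := by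
  have : goodBase k v ε = ⋂ w ∈ Finset.univ.filter (fun w => kosinskiGamma8 v w = 1),
      {p : 𝕊 k | ⟪(p : 𝔼 (k + 1)), (pole k (ecol v w).val : 𝔼 (k + 1))⟫ < Real.sqrt (1 - ε)} := by
    ext p; simp [goodBase]
  rw [this]
  exact isOpen_biInter_finset fun w _ => isOpen_lt (by fun_prop) continuous_const

/-- **On the good base region the cap value exceeds `ε`** (`0 < ε < r²`). [folklore] -/
theorem lt_capA (hk : 2 ≤ k) (hc : IsParam c) (v : Fin 8) {ε : ℝ} (hεR : ε < rsq c)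
    {p : 𝕊 k} (hp : p ∈ goodBase k v ε) : ε < capA k c v p := by
  by_cases hcap : ∃ w, kosinskiGamma8 v w = 1 ∧ c < ⟪(p : 𝔼 (k + 1)), (pole k (ecol v w).val : 𝔼 (k + 1))⟫
  · obtain ⟨w, hvw, h⟩ := hcap
    rw [capA_eq_aP hk hc hvw h, aP]
    have h1 := hp w hvw
    have h0 : 0 ≤ ⟪(p : 𝔼 (k + 1)), (pole k (ecol v w).val : 𝔼 (k + 1))⟫ := hc.nonneg.trans h.le
    have hR1 : rsq c ≤ 1 := by rw [rsq]; nlinarith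
    have hs : Real.sqrt (1 - ε) ^ 2 = 1 - ε := Real.sq_sqrt (by linarith)
    nlinarith [Real.sqrt_nonneg (1 - ε)]
  · push Not at hcap
    rw [capA_eq_rsq v hcap]; exact hεR


variable (k c) in
/-- **The level radius** `β̂ᵥ(p) = β(Aᵥ(p))`: the unique squared fibre radius at which the radial
profile of the `v`-th tube crosses the level `ε` (for `p` with `ε < Aᵥ(p)`). [folklore] -/
def levelRad (v : Fin 8) (ε : ℝ) (p : 𝕊 k) : ℝ := betaFn c ε (capA k c v p)

/-- `levelRad` unfolds to `β ∘ Aᵥ`. [folklore] -/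
theorem levelRad_eq (v : Fin 8) (ε : ℝ) (p : 𝕊 k) : levelRad k c v ε p = betaFn c ε (capA k c v p) := rfl

section LevelRad

variable (hk : 2 ≤ k) (hc : IsParam c) (v : Fin 8) {ε : ℝ} (hε : 0 < ε)
include hk hc hε

/-- `Φᵥ(p, β̂ᵥ(p)) = ε`. [folklore] -/
theorem profile_levelRad {p : 𝕊 k} (hp : ε < capA k c v p) : profile k c v p (levelRad k c v ε p) = ε := by
  have haR := capA_le_rsq hc v p
  rw [levelRad, profile_eq_cornerFn_capA hk hc v p (betaFn_lt_rsq hε hp haR)]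
  exact cornerFn_betaFn hε hp haR

/-- **Uniqueness**: any root of `Φᵥ(p, ·) = ε` in `[0, b₁(A(p)))` is the level radius. [folklore] -/
theorem eq_levelRad {p : 𝕊 k} (hp : ε < capA k c v p) {b : ℝ} (hb : b ∈ Ico 0 (sbound c (capA k c v p)))
    (h : profile k c v p b = ε) : b = levelRad k c v ε p := by
  have haR := capA_le_rsq hc v p
  rw [profile_eq_cornerFn_capA hk hc v p (hb.2.trans_le (sbound_le_rsq haR))] at h
  exact eq_betaFn hε hp haR hb h

omit hk in
/-- The level radius is positive. [folklore] -/
theorem levelRad_pos {p : 𝕊 k} (hp : ε < capA k c v p) : 0 < levelRad k c v ε p :=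
  betaFn_pos hε hp (capA_le_rsq hc v p)

omit hk in
/-- `ε ≤ β̂(p)`. [folklore] -/
theorem le_levelRad {p : 𝕊 k} (hp : ε < capA k c v p) : ε ≤ levelRad k c v ε p :=
  le_betaFn hε hp (capA_le_rsq hc v p)

omit hk in
/-- The level radius is `< r²`. [folklore] -/
theorem levelRad_lt_rsq {p : 𝕊 k} (hp : ε < capA k c v p) : levelRad k c v ε p < rsq c :=
  betaFn_lt_rsq hε hp (capA_le_rsq hc v p)

omit hk in
/-- The level radius is `< b₁(A(p))`. [folklore] -/
theorem levelRad_lt_sbound {p : 𝕊 k} (hp : ε < capA k c v p) : levelRad k c v ε p < sbound c (capA k c v p) :=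
  betaFn_lt_sbound hε hp (capA_le_rsq hc v p)

omit hk in
/-- **Continuity of the level radius** on `{ε < Aᵥ}` (in particular on the good base region):
`β̂ᵥ = β ∘ Aᵥ` with `β` continuous on `(ε, r²]` and `Aᵥ` continuous with values `≤ r²`. [folklore] -/
theorem continuousOn_levelRad : ContinuousOn (levelRad k c v ε) {p | ε < capA k c v p} := by
  refine (continuousOn_betaFn hε).comp (continuous_capA v).continuousOn ?_
  intro p hp; exact ⟨hp, capA_le_rsq hc v p⟩

omit hk in
/-- `continuousAt_levelRad` (continuousAt levelRad). [folklore] -/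
theorem continuousAt_levelRad {p : 𝕊 k} (hp : ε < capA k c v p) : ContinuousAt (levelRad k c v ε) p :=
  (continuousOn_levelRad hc v hε).continuousAt ((isOpen_lt continuous_const (continuous_capA v)).mem_nhds hp)

/-- **Over `{ε < Aᵥ}`, a point of the tube is on the level iff its squared fibre radius is the
level radius.** [folklore] -/
theorem rhoHat_eq_iff_bFn_eq_levelRad {pq : (𝕊 k) × (𝕊 k)} (htube : c < fibHt pq) (hp : ε < capA k c v pq.1) :
    rhoHat k c v pq = ε ↔ bFn pq = levelRad k c v ε pq.1 := by
  rw [rhoHat_eq_profile v htube]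
  constructor
  · intro h
    have hbR : bFn pq < rsq c := bFn_lt hc.nonneg htube
    have hb0 : 0 ≤ bFn pq := bFn_nonneg pq
    refine eq_levelRad hk hc v hε hp ⟨hb0, ?_⟩ h
    rw [profile_eq_cornerFn_capA hk hc v pq.1 hbR] at h
    exact lt_sbound_of_cornerFn_lt (by linarith [capA_le_rsq hc v pq.1]) (by rw [h]; exact hp)
  · intro h
    rw [h]; exact profile_levelRad hk hc v hε hp

end LevelRad

end Profile

end Plumbing

end Literature.Topology.FourManifolds
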